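import Literature.Probability.Process.RenewalTheorem
import HarnessLib

/-!
# Erickson's renewal sandwich (Erickson 1973, Lemma 1), discrete form:
# `N + 1 ≤ (Σ_{n ≤ N} uₙ) · (Σ_{j ≤ N} r_j) ≤ 2N + 1`

Topic `Literature/Probability/Process`, continuing `RenewalSequenceRecurrence.lean` / `RenewalTheorem.lean`
(same conventions: `u, f : ℕ → ℝ`, `u₀ = 1`, `f₀ = 0`, renewal equation `uₙ = Σ_{k ≤ n} f_k u_{n-k}` for
`n ≥ 1`, tail sums `r_n = 1 - Σ_{k ≤ n} f_k` supplied through the hypothesis `hr`; the conservation law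
`Σ_{k ≤ n} r_k u_{n-k} = 1` is `Renewal.sum_tailSum_mul_eq_one`, Madras–Slade (B.5)).

Source: K. B. Erickson, *The strong law of large numbers when the mean is undefined*, Trans. Amer. Math.
Soc. 185 (1973), 371–381 [`Erickson1973`; held: the AMS open back-issue PDF], **Lemma 1 (p. 377)**: "Let `G`
be any probability distribution concentrated on `[0, ∞)` (but not all the mass at the origin). Put
`U(t) = Σ_{n=0}^{∞} G^{n*}(t)`, `m(t) = ∫_0^t [1 - G(x)] dx` where `G^{n*}` is the `n`-fold convolution.
Then (4.1) `1 ≤ m(t)U(t)/t ≤ 2` for all `t > 0` and (4.2) `min(1, a/2) ≤ U(at)/U(t) ≤ max(1, 2a)` for all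
`t > 0`, `a > 0`." Printed proof of (4.1) (p. 377): "`U` satisfies the renewal equation `U = 1 + G∗U` …
Integrating this over `0 ≤ x ≤ t` gives `t = ∫_0^t m(t-y) dU(y)`. Since `m` is nondecreasing … (4.1)
follows." Secondary sources quoting it: D. Denisov, S. Foss, D. Korshunov, *Tail asymptotics for the supremum
of a random walk when the mean is not finite*, Queueing Syst. 46 (2004) (arXiv:1303.4715, p. 5: "(see
[Erickson, Lemma 1] or [BGT, Section 8.6.3]). Without any assumptions, for every `x ≥ 0`,
`x / E min{χ, x} ≤ H([0,x]) ≤ 2x / E min{χ, x}`", `H` the renewal measure of a renewal process with step law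
`χ`); N. H. Bingham, C. M. Goldie, J. L. Teugels, *Regular Variation* (1987), §8.6.3.
The statement below is the DISCRETE (arithmetic, span `1`) form of (4.1): with Erickson's `U(t)` constant on
`[N, N+1)` and equal to `Σ_{n ≤ N} uₙ` there, and `m(N+1) = Σ_{j ≤ N} P(χ > j) = Σ_{j ≤ N} r_j` (`m` is piecewise
linear), the printed sandwich at `t = N + 1` reads `N+1 ≤ (Σ_{n≤N+1} uₙ)(Σ_{j≤N} r_j) ≤ 2(N+1)`; the discrete
double-sum identity proved below gives the lower half already with `Σ_{n ≤ N} uₙ` and the upper half with the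
marginally sharper constant `2N + 1`.
-- TODO(general form): non-arithmetic step laws / renewal measures on `[0,∞)` (the printed setting), and (4.2).

Proof ("without any assumptions" beyond `u ≥ 0`, `r ≥ 0`): summing the conservation law over `M ≤ N` gives the
DOUBLE-SUM IDENTITY `Σ_{n ≤ N} uₙ · Σ_{k ≤ N-n} r_k = N + 1`; bounding the inner sums by `Σ_{k ≤ N} r_k` gives
the lower half, and keeping only `n ≤ N` in the identity at `2N` (where the inner sums are `≥ Σ_{k ≤ N} r_k`)
gives the upper half.

## Contents (namespace `Literature.Probability.Process.Renewal`), all PROVED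

* `sum_mul_tailSum_reflect_eq_one` — the conservation law reflected, `Σ_{n ≤ N} uₙ r_{N-n} = 1`;
* `sum_mul_sum_tailSum_eq` — the double-sum identity `Σ_{n ≤ N} uₙ Σ_{k ≤ N-n} r_k = N + 1`;
* **`erickson_lower`** — `N + 1 ≤ (Σ_{n ≤ N} uₙ)(Σ_{k ≤ N} r_k)`;
* **`erickson_upper`** — `(Σ_{n ≤ N} uₙ)(Σ_{k ≤ N} r_k) ≤ 2N + 1`;
* `erickson_lower_of_hasSum`, `erickson_upper_of_hasSum` — the same for a proper renewal (`f ≥ 0`, `Σ f = 1`,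
  so that `r ≥ 0` is automatic).
-/

noncomputable section

open Finset

namespace Literature.Probability.Process.Renewal

variable {u f r : ℕ → ℝ}

/-- **The conservation law, reflected**: `Σ_{n ≤ N} uₙ r_{N-n} = 1` for every `N`.
[cite: MadrasSlade1993, Appendix B, eq. (B.5)] -/
theorem sum_mul_tailSum_reflect_eq_one
    (hr : ∀ n, r n = 1 - ∑ k ∈ range (n + 1), f k) (hu0 : u 0 = 1) (hf0 : f 0 = 0)
    (hren : ∀ n, 1 ≤ n → u n = ∑ k ∈ range (n + 1), f k * u (n - k)) (N : ℕ) :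
    ∑ n ∈ range (N + 1), u n * r (N - n) = 1 := by
  have h := sum_tailSum_mul_eq_one hr hu0 hf0 hren N
  rw [← sum_range_reflect] at h
  refine Eq.trans (sum_congr rfl fun n hn => ?_) h
  rw [mem_range] at hn
  have h1 : N + 1 - 1 - n = N - n := by omega
  have h2 : N - (N - n) = n := by omega
  rw [h1, h2, mul_comm]

/-- **The double-sum identity** (the conservation law summed over `M ≤ N`):
`Σ_{n ≤ N} uₙ · Σ_{k ≤ N-n} r_k = N + 1`. [cite: Erickson1973, Lemma 1 (proof); MadrasSlade1993, Appendix B, eq. (B.5)] -/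
theorem sum_mul_sum_tailSum_eq
    (hr : ∀ n, r n = 1 - ∑ k ∈ range (n + 1), f k) (hu0 : u 0 = 1) (hf0 : f 0 = 0)
    (hren : ∀ n, 1 ≤ n → u n = ∑ k ∈ range (n + 1), f k * u (n - k)) (N : ℕ) :
    ∑ n ∈ range (N + 1), u n * ∑ k ∈ range (N - n + 1), r k = (N : ℝ) + 1 := by
  induction N with
  | zero => simp [hu0, tailSum_zero hr hf0]
  | succ N ih =>
    have hC := sum_mul_tailSum_reflect_eq_one hr hu0 hf0 hren (N + 1)
    -- split off `n = N + 1` and, inside, the top term `k = N + 1 - n` of each inner sum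
    have hsplit : ∀ n ∈ range (N + 1),
        u n * ∑ k ∈ range (N + 1 - n + 1), r k = u n * ∑ k ∈ range (N - n + 1), r k + u n * r (N + 1 - n) := by
      intro n hn
      rw [mem_range] at hn
      have e : N + 1 - n + 1 = N - n + 1 + 1 := by omega
      rw [e, sum_range_succ, mul_add]
      have e' : N - n + 1 = N + 1 - n := by omega
      rw [e']
    rw [sum_range_succ, sum_congr rfl hsplit, sum_add_distrib, ih]
    rw [sum_range_succ] at hC
    have e2 : N + 1 - (N + 1) + 1 = 1 := by omega
    rw [e2, sum_range_one]
    rw [Nat.sub_self] at hC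
    push_cast
    linarith

/-- **Erickson's sandwich, lower half** ("without any assumptions": `u ≥ 0`, `r ≥ 0`):
`N + 1 ≤ (Σ_{n ≤ N} uₙ) · (Σ_{k ≤ N} r_k)` — i.e. `x / E min{χ,x} ≤ H([0,x])` at `x = N+1`.
[cite: Erickson1973, Lemma 1] -/
theorem erickson_lower
    (hr : ∀ n, r n = 1 - ∑ k ∈ range (n + 1), f k) (hu0 : u 0 = 1) (hf0 : f 0 = 0)
    (hren : ∀ n, 1 ≤ n → u n = ∑ k ∈ range (n + 1), f k * u (n - k))
    (hu : ∀ n, 0 ≤ u n) (hrnn : ∀ n, 0 ≤ r n) (N : ℕ) :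
    (N : ℝ) + 1 ≤ (∑ n ∈ range (N + 1), u n) * ∑ k ∈ range (N + 1), r k := by
  rw [← sum_mul_sum_tailSum_eq hr hu0 hf0 hren N, sum_mul]
  refine sum_le_sum fun n hn => mul_le_mul_of_nonneg_left ?_ (hu n)
  exact sum_le_sum_of_subset_of_nonneg (range_subset_range.2 (by omega)) fun k _ _ => hrnn k

/-- **Erickson's sandwich, upper half** (`u ≥ 0`, `r ≥ 0`): `(Σ_{n ≤ N} uₙ) · (Σ_{k ≤ N} r_k) ≤ 2N + 1` — keep the
terms `n ≤ N` of the double-sum identity at `2N`; i.e. `H([0,x]) ≤ 2x / E min{χ,x}`.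
[cite: Erickson1973, Lemma 1] -/
theorem erickson_upper
    (hr : ∀ n, r n = 1 - ∑ k ∈ range (n + 1), f k) (hu0 : u 0 = 1) (hf0 : f 0 = 0)
    (hren : ∀ n, 1 ≤ n → u n = ∑ k ∈ range (n + 1), f k * u (n - k))
    (hu : ∀ n, 0 ≤ u n) (hrnn : ∀ n, 0 ≤ r n) (N : ℕ) :
    (∑ n ∈ range (N + 1), u n) * ∑ k ∈ range (N + 1), r k ≤ 2 * (N : ℝ) + 1 := by
  have hid := sum_mul_sum_tailSum_eq hr hu0 hf0 hren (2 * N)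
  have hnn : ∀ n ∈ range (2 * N + 1), 0 ≤ u n * ∑ k ∈ range (2 * N - n + 1), r k :=
    fun n _ => mul_nonneg (hu n) (sum_nonneg fun k _ => hrnn k)
  calc (∑ n ∈ range (N + 1), u n) * ∑ k ∈ range (N + 1), r k
      = ∑ n ∈ range (N + 1), u n * ∑ k ∈ range (N + 1), r k := sum_mul _ _ _
    _ ≤ ∑ n ∈ range (N + 1), u n * ∑ k ∈ range (2 * N - n + 1), r k := by
        refine sum_le_sum fun n hn => mul_le_mul_of_nonneg_left ?_ (hu n)
        rw [mem_range] at hn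
        exact sum_le_sum_of_subset_of_nonneg (range_subset_range.2 (by omega)) fun k _ _ => hrnn k
    _ ≤ ∑ n ∈ range (2 * N + 1), u n * ∑ k ∈ range (2 * N - n + 1), r k :=
        sum_le_sum_of_subset_of_nonneg (range_subset_range.2 (by omega)) fun n hn _ => hnn n hn
    _ = 2 * (N : ℝ) + 1 := by rw [hid]; push_cast; ring

/-- Erickson's lower half for a proper renewal (`f ≥ 0`, `Σ f = 1`, `u ≥ 0`). [cite: Erickson1973, Lemma 1] -/
theorem erickson_lower_of_hasSum
    (hr : ∀ n, r n = 1 - ∑ k ∈ range (n + 1), f k) (hu0 : u 0 = 1) (hf0 : f 0 = 0)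
    (hren : ∀ n, 1 ≤ n → u n = ∑ k ∈ range (n + 1), f k * u (n - k))
    (hu : ∀ n, 0 ≤ u n) (hf : ∀ k, 0 ≤ f k) (hf1 : HasSum f 1) (N : ℕ) :
    (N : ℝ) + 1 ≤ (∑ n ∈ range (N + 1), u n) * ∑ k ∈ range (N + 1), r k :=
  erickson_lower hr hu0 hf0 hren hu (tailSum_nonneg hr hf hf1) N

/-- Erickson's upper half for a proper renewal (`f ≥ 0`, `Σ f = 1`, `u ≥ 0`). [cite: Erickson1973, Lemma 1] -/
theorem erickson_upper_of_hasSum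
    (hr : ∀ n, r n = 1 - ∑ k ∈ range (n + 1), f k) (hu0 : u 0 = 1) (hf0 : f 0 = 0)
    (hren : ∀ n, 1 ≤ n → u n = ∑ k ∈ range (n + 1), f k * u (n - k))
    (hu : ∀ n, 0 ≤ u n) (hf : ∀ k, 0 ≤ f k) (hf1 : HasSum f 1) (N : ℕ) :
    (∑ n ∈ range (N + 1), u n) * ∑ k ∈ range (N + 1), r k ≤ 2 * (N : ℝ) + 1 :=
  erickson_upper hr hu0 hf0 hren hu (tailSum_nonneg hr hf hf1) N

end Literature.Probability.Process.Renewal
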